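import Summits.BirchSwinnertonDyer.BirchSwinnertonDyer.Theorems.AlignedTransportAtTwoMainConjectureOfRankZeroBSDAtTwoFineRoadRelaxedCongruence
import Summits.BirchSwinnertonDyer.BirchSwinnertonDyer.Theorems.AlignedTransportAtTwoMainConjectureOfRankZeroBSDAtTwoFineRoadQuadraticTwist
import Literature.NumberTheory.EllipticCurves.IwasawaModuleFinitePadicIntProofs
import HarnessLib

/-!
# K4 crux `AdditiveRankZeroAtTwo` (item 19098), child C1″ `FineSelmerConjAAtTwoAdditivePotGood`: the SHARED SUPPLY
# BRICK S-LS2 — statement (A) at `2` is an invariant of the Galois module `E[2]` among curves of NEGATIVE discriminant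
# (Lim–Sujatha Prop. 3.2 at `(ℚ, 2)`, `Δ < 0`), and hence of the quadratic-twist class

Cell `bsd-2adic`, seat `bsd-2adic-addL2x` GEN 12, on planner RC-256 (B) («S-LS2 = kernel target
`conjA_two_iff_of_torsionIso_of_Δ_neg` + corollary `conjA_two_iff_quadraticTwist_negOne_of_Δ_neg` → additive lane;
`--supports 19098 --as helper` now, C1″ after the split; second consumer 19573 L2»). HONEST FRAMING: a re-currencying of
theorems ALREADY IN THE TREE (cell `bsd-f1-sign2`, seats `bsd-line-att-p4/p5`:
`AlignedTransportAtTwoFineRoad.RelaxedCongruence.finite_twoTorsion_iff_of_torsionIso_of_Δ_neg` — Lim–Sujatha Prop. 3.2 in the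
RELAXED-at-`∞` currency for every `p`, and relaxed = strict at `(ℚ, 2)` for `Δ < 0` — and
`AlignedTransportAtTwoFineRoad.QuadraticTwist.exists_torsionIso_two_*`) into the currency of statement (A) used by C1″ / `_v4`
(`∃ γ D, Module.Finite ℤ₂ D.X`, bridge `IwasawaModuleFinitePadicInt.exists_fineSelmerDualData_moduleFinite_iff_finite_pTorsion`);
no new mathematics, closes nothing; BSD is not proved by any of this. Theorems only.

* `conjA_two_iff_of_torsionIso_of_Δ_neg` — `E₁[2] ≅ E₂[2]` equivariantly, `Δ(E₁), Δ(E₂) < 0` ⟹ ((A)₂(E₁) ⟺ (A)₂(E₂)) along the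
  cyclotomic `ℤ₂`-extension.
* `conjA_two_iff_quadraticTwist_of_Δ_neg` — `Δ(W) < 0`, `d ≠ 0` ⟹ ((A)₂(W^{(d)}) ⟺ (A)₂(W)) for the tree's twist model
  (`Δ(W^{(d)}) = d⁶Δ(W) < 0`); `conjA_two_iff_of_smul_eq_quadraticTwist_of_Δ_neg` — the same for EVERY model `W′` of the twist
  (`C • W′ = W.quadraticTwist d`), e.g. its globally minimal model; `d = −1` is the χ₋₄-twist of RC-256.

Why `Δ < 0`: at `(ℚ, 2)` the strict fine Selmer condition at the real place sees `H¹(Gal(ℂ/ℝ), E[2])`, which vanishes iff complex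
conjugation acts freely on `E[2]` (`E[2] ≅ 𝔽₂[C₂]`), i.e. iff `E(ℝ)[2] = ℤ/2`, i.e. iff `Δ < 0`; for `Δ > 0` the archimedean
kernel has index `2` (tree: `…FineRoadRealKummerLine.relIndex_infKer_comap_eq_two`).
-/

set_option autoImplicit false
set_option linter.dupNamespace false

noncomputable section

open scoped Classical

namespace Summit.BirchSwinnertonDyer.BirchSwinnertonDyer.Theorems.AddKatoTwo

open WeierstrassCurve Field Literature.NumberTheory.EllipticCurves
  Summit.BirchSwinnertonDyer.BirchSwinnertonDyer.Theorems.AlignedTransportAtTwoFineRoad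

variable (W₁ W₂ : WeierstrassCurve ℚ) [W₁.IsElliptic] [W₂.IsElliptic]

/-- **S-LS2: statement (A) at `2` is an invariant of `E[2]` among curves of negative discriminant** (Lim–Sujatha 2018
Prop. 3.2 at `(ℚ, 2)` — the case the printed proposition excludes — for `Δ < 0`): if `E₁[2] ≅ E₂[2]` as `Γ_ℚ`-modules and
`Δ(E₁), Δ(E₂) < 0`, then along the cyclotomic `ℤ₂`-extension the fine Selmer dual of `E₁` is finitely generated over `ℤ₂` iff
that of `E₂` is. [cite: LimSujatha2018, §3 Prop. 3.2 (arXiv:1603.08640 p. 8)] [cite: GreenbergLNM1716, §4 (PDF p. 106)]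
[cite: CoatesSujatha2005, statement (A) (§3)] -/
theorem conjA_two_iff_of_torsionIso_of_Δ_neg (h₁ : W₁.Δ < 0) (h₂ : W₂.Δ < 0)
    (e : (W₁.geomTorsion ((2 : ℕ) : ℤ)) ≃+ (W₂.geomTorsion ((2 : ℕ) : ℤ)))
    (he : ∀ (σ : absoluteGaloisGroup ℚ) (P : W₁.geomTorsion ((2 : ℕ) : ℤ)), e (σ • P) = σ • e P)
    (κ : ZpExtension ℚ 2) (hκ : κ.IsCyclotomic) :
    (∃ (γ : absoluteGaloisGroup ℚ) (D : W₁.FineSelmerDualData κ γ),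
        Module.Finite ℤ_[2] (RestrictScalars ℤ_[2] (IwasawaAlgebra 2) D.X)) ↔
      ∃ (γ : absoluteGaloisGroup ℚ) (D : W₂.FineSelmerDualData κ γ),
        Module.Finite ℤ_[2] (RestrictScalars ℤ_[2] (IwasawaAlgebra 2) D.X) := by
  haveI : Fact (Nat.Prime 2) := ⟨Nat.prime_two⟩
  obtain ⟨γ₀, hγ₀⟩ : ∃ γ : absoluteGaloisGroup ℚ, κ.IsTopGenerator γ := κ.surjective (Multiplicative.ofAdd 1)
  rw [IwasawaModuleFinitePadicInt.exists_fineSelmerDualData_moduleFinite_iff_finite_pTorsion W₁ κ hγ₀,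
    IwasawaModuleFinitePadicInt.exists_fineSelmerDualData_moduleFinite_iff_finite_pTorsion W₂ κ hγ₀]
  exact RelaxedCongruence.finite_twoTorsion_iff_of_torsionIso_of_Δ_neg W₁ W₂ κ hκ h₁ h₂ e he

variable (W : WeierstrassCurve ℚ) [W.IsElliptic]

/-- **(A)₂ is a quadratic-twist invariant for `Δ < 0`** (tree twist model): for `d ≠ 0`, `Δ(W^{(d)}) = d⁶·Δ(W) < 0` and
`W^{(d)}[2] ≅ W[2]` equivariantly (`QuadraticTwist.exists_torsionIso_two_quadraticTwist`), so (A)₂(W^{(d)}) ⟺ (A)₂(W); `d = −1`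
is the χ₋₄-twist pairing the additive potentially-good residue classes of C1″ with 19573's DD12 residue (planner RC-256).
[cite: LimSujatha2018, §3 Prop. 3.2] [cite: SilvermanAEC2009, X.5 Cor. 5.4] -/
theorem conjA_two_iff_quadraticTwist_of_Δ_neg (hΔ : W.Δ < 0) {d : ℚ} (hd : d ≠ 0)
    [(W.quadraticTwist d).IsElliptic] (κ : ZpExtension ℚ 2) (hκ : κ.IsCyclotomic) :
    (∃ (γ : absoluteGaloisGroup ℚ) (D : (W.quadraticTwist d).FineSelmerDualData κ γ),
        Module.Finite ℤ_[2] (RestrictScalars ℤ_[2] (IwasawaAlgebra 2) D.X)) ↔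
      ∃ (γ : absoluteGaloisGroup ℚ) (D : W.FineSelmerDualData κ γ),
        Module.Finite ℤ_[2] (RestrictScalars ℤ_[2] (IwasawaAlgebra 2) D.X) := by
  obtain ⟨e, he⟩ := QuadraticTwist.exists_torsionIso_two_quadraticTwist W hd
  have hΔd : (W.quadraticTwist d).Δ < 0 := by
    rw [quadraticTwist_Δ]
    exact mul_neg_of_pos_of_neg (by positivity) hΔ
  exact conjA_two_iff_of_torsionIso_of_Δ_neg (W.quadraticTwist d) W hΔd hΔ e he κ hκ

/-- **(A)₂ is a quadratic-twist invariant for `Δ < 0`, any model**: for EVERY elliptic `W′` with `C • W′ = W.quadraticTwist d`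
(`d ≠ 0`; e.g. the globally minimal model of the twist), `Δ(W′) = u¹²·d⁶·Δ(W) < 0` and `W′[2] ≅ W[2]` equivariantly
(`QuadraticTwist.exists_torsionIso_two_of_smul_eq_quadraticTwist`), so (A)₂(W′) ⟺ (A)₂(W).
[cite: LimSujatha2018, §3 Prop. 3.2] [cite: SilvermanAEC2009, X.5 Cor. 5.4 and III.3.1(b)] -/
theorem conjA_two_iff_of_smul_eq_quadraticTwist_of_Δ_neg (W' : WeierstrassCurve ℚ) [W'.IsElliptic] (hΔ : W.Δ < 0)
    {d : ℚ} (hd : d ≠ 0) {C : VariableChange ℚ} (hC : C • W' = W.quadraticTwist d)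
    (κ : ZpExtension ℚ 2) (hκ : κ.IsCyclotomic) :
    (∃ (γ : absoluteGaloisGroup ℚ) (D : W'.FineSelmerDualData κ γ),
        Module.Finite ℤ_[2] (RestrictScalars ℤ_[2] (IwasawaAlgebra 2) D.X)) ↔
      ∃ (γ : absoluteGaloisGroup ℚ) (D : W.FineSelmerDualData κ γ),
        Module.Finite ℤ_[2] (RestrictScalars ℤ_[2] (IwasawaAlgebra 2) D.X) := by
  obtain ⟨e, he⟩ := QuadraticTwist.exists_torsionIso_two_of_smul_eq_quadraticTwist W W' hd hC
  have hΔ' : W'.Δ < 0 := by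
    have h1 : (C • W').Δ = d ^ 6 * W.Δ := by rw [hC, quadraticTwist_Δ]
    rw [variableChange_Δ] at h1
    -- `u⁻¹² · Δ(W′) = d⁶ · Δ(W)` with `u⁻¹² > 0`
    have hu : (0 : ℚ) < (↑C.u⁻¹ : ℚ) ^ 12 := Even.pow_pos (by decide) (Units.ne_zero _)
    have hneg : (↑C.u⁻¹ : ℚ) ^ 12 * W'.Δ < 0 := by
      rw [h1]; exact mul_neg_of_pos_of_neg (by positivity) hΔ
    by_contra hge
    exact absurd hneg (not_lt.mpr (mul_nonneg hu.le (not_lt.mp hge)))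
  exact conjA_two_iff_of_torsionIso_of_Δ_neg W' W hΔ' hΔ e he κ hκ

end Summit.BirchSwinnertonDyer.BirchSwinnertonDyer.Theorems.AddKatoTwo

end
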